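import Literature.Probability.LatticeModels.AizenmanHiguchiFromInvariance
import Literature.Probability.LatticeModels.DominationFromNoBadPercolation
import Literature.Probability.LatticeModels.ProductTailTriviality
import Literature.Probability.LatticeModels.ButterflyPeriodicity
import HarnessLib

/-!
# Aizenman–Higuchi: assembly of Proposition 5.1 from the absence of (+,−)-percolation
# (Georgii–Higuchi 2000, §5, end of the proofs of Lemma 5.5 and Prop. 5.1)

Topic `Probability/LatticeModels`; theorems only (no named facts). Georgii–Higuchi, J. Math. Phys.
41 (2000), §5 prove the Aizenman–Higuchi theorem as: **Lemma 5.5** (for an extremal `μ ∈ 𝒢` and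
its horizontal translate `μ̂ = μ ∘ θ_h⁻¹`, `ν̂ = μ ⊗ μ̂`-almost surely every finite square is
surrounded by a `≤∗`circuit) ⇒ **Prop. 5.1** (`μ = μ̂`, "as in Aizenman", and the same vertically)
⇒ **Theorem** (mixture, with Cor. 3.2). The tree already has the two ends of this chain:

* `eq_of_no_bad_percolation` (`DominationFromNoBadPercolation`): `μ = μ'` as soon as, under
  `μ ⊗ μ'` and under `μ' ⊗ μ`, almost surely no lattice cluster of bad sites `{ω = +1, ω' = -1}` is
  infinite (the circuit-free form of "every square is surrounded by a `≤∗`circuit");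
* `aizenman_higuchi_of_tailTrivial_translationInvariant` (`AizenmanHiguchiFromInvariance`): the
  named fact `aizenman_higuchi` follows from the translation invariance of every tail-trivial
  `μ ∈ 𝒢(β, 0)` on `ℤ²`, `β > β_c(2)`.

This file supplies the glue in between, so that the one remaining input is exactly the content
of Georgii–Higuchi's Lemma 5.5 (Cases 1–3 of its proof, pp. 15–16), in the weakest form their
proof delivers ("with probability at least `(θ/4)⁴` each finite set is surrounded by a
`≤∗`circuit. Since this event is measurable with respect to the product-tail `𝒯⁽²⁾` on which `ν̂`
is trivial, the lemma follows"):

* `measurableSet_prodTailEvents_badPercolation` — *bad percolation*, "some lattice cluster of bad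
  sites `{ω = +1, ω̂ = -1}` is infinite", is a product-tail event (`ProductTailTriviality`);
* `measure_badPercolation_eq_zero_of_enclosure` — **0–1 upgrade**: for tail-trivial `μ, μ'`, if
  with probability `≥ c > 0` (uniformly in `n`) no bad cluster meeting `Λ_n` is infinite, then
  almost surely no bad cluster is infinite;
* `ae_no_badPercolation_prod_map_configShift` — **interchanging the layers**: the statement for
  `(μ ∘ θ_v⁻¹) ⊗ μ` is the statement for `μ ⊗ (μ ∘ θ_{-v}⁻¹)` transported along `θ_v × θ_v`;
* `isTranslationInvariantMeasure_of_generators` — invariance under `θ_{e_0}, θ_{e_1}` gives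
  invariance under all of `ℤ²`;
* **`aizenman_higuchi_of_ae_no_badPercolation`**, **`aizenman_higuchi_of_enclosure_bound`** — the
  named fact `aizenman_higuchi` from Lemma 5.5 for the four unit translates `μ ∘ θ_{±e_i}⁻¹` of
  every tail-trivial `μ ∈ 𝒢(β, 0)`, `β > β_c(2)`, in almost-sure resp. positive-probability form.

## References

* H.-O. Georgii, Y. Higuchi, *Percolation and number of phases in the two-dimensional Ising
  model*, J. Math. Phys. 41 (2000) 1153–1169, Lemma 5.5 and Prop. 5.1 with their proofs (pp. 15–16
  of arXiv:math/9907186) [GeorgiiHiguchi2000].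
* M. Aizenman, Comm. Math. Phys. 73 (1980) 83–94 (the duplicated system).
-/

noncomputable section

open MeasureTheory ProbabilityTheory Filter Topology
open Literature.Probability.Percolation
open scoped ENNReal

namespace Literature.Probability.LatticeModels

/-! ### Bad percolation is a product-tail event -/

section BadTail

/-- Membership in `badPercolation`. [cite: GeorgiiHiguchi2000, Lemma 5.5] -/
theorem mem_badPercolation_iff {p : SpinConfig (Site 2) × SpinConfig (Site 2)} :
    p ∈ {p : SpinConfig (Site 2) × SpinConfig (Site 2) |
      ∃ x, (siteCluster (zdGraph 2) (spinSites 1 (badConfig p)) x).Infinite} ↔ ∃ x, (siteCluster (zdGraph 2) (spinSites 1 (badConfig p)) x).Infinite :=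
  Iff.rfl

/-- The complement of bad percolation: every bad cluster is finite. [cite: GeorgiiHiguchi2000, Lemma 5.5] -/
theorem not_mem_badPercolation_iff {p : SpinConfig (Site 2) × SpinConfig (Site 2)} :
    p ∉ {p : SpinConfig (Site 2) × SpinConfig (Site 2) |
      ∃ x, (siteCluster (zdGraph 2) (spinSites 1 (badConfig p)) x).Infinite} ↔ ∀ x, ¬ (siteCluster (zdGraph 2) (spinSites 1 (badConfig p)) x).Infinite := by
  rw [mem_badPercolation_iff, not_exists]

/-- `p ↦ S_bad(p) ∖ Λ` is measurable with respect to the two layers off `Λ`. [cite: GeorgiiHiguchi2000, Lemma 5.5 (proof, p. 16)] -/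
theorem measurable_spinSites_badConfig_diff (Λ : Finset (Site 2)) :
    Measurable[(cylinderEvents (X := fun _ : Site 2 => ℤˣ) ((↑Λ : Set (Site 2))ᶜ)).prod
        (cylinderEvents (X := fun _ : Site 2 => ℤˣ) ((↑Λ : Set (Site 2))ᶜ))]
      fun p : SpinConfig (Site 2) × SpinConfig (Site 2) => spinSites 1 (badConfig p) \ ↑Λ := by
  letI m : MeasurableSpace (SpinConfig (Site 2)) :=
    cylinderEvents (X := fun _ : Site 2 => ℤˣ) ((↑Λ : Set (Site 2))ᶜ)
  refine @measurable_set_iff _ _ (m.prod m) _ |>.2 fun a => ?_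
  by_cases ha : a ∈ (↑Λ : Set (Site 2))
  · have : (fun p : SpinConfig (Site 2) × SpinConfig (Site 2) => a ∈ spinSites 1 (badConfig p) \ ↑Λ) =
        fun _ => False := by
      funext p; simp [ha]
    rw [this]
    exact @measurable_const Prop _ _ (m.prod m) False
  · have : (fun p : SpinConfig (Site 2) × SpinConfig (Site 2) => a ∈ spinSites 1 (badConfig p) \ ↑Λ) =
        fun p => p.1 a = 1 ∧ p.2 a = -1 := by
      funext p
      simp only [Set.mem_sdiff, ha, not_false_eq_true, and_true]
      exact propext mem_spinSites_badConfig
    rw [this]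
    have hcoord : Measurable[m] fun ω : SpinConfig (Site 2) => ω a :=
      measurable_cylinderEvent_apply (X := fun _ : Site 2 => ℤˣ) ha
    have h1 : Measurable[m.prod m] fun p : SpinConfig (Site 2) × SpinConfig (Site 2) => p.1 a :=
      @Measurable.comp _ _ _ (m.prod m) m _ _ _ hcoord (@measurable_fst _ _ m m)
    have h2 : Measurable[m.prod m] fun p : SpinConfig (Site 2) × SpinConfig (Site 2) => p.2 a :=
      @Measurable.comp _ _ _ (m.prod m) m _ _ _ hcoord (@measurable_snd _ _ m m)
    exact (h1.eq_const 1).and (h2.eq_const (-1))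

/-- **Bad percolation is decided off every finite `Λ`**: it belongs to `𝓕_{Λᶜ} ⊗ 𝓕_{Λᶜ}`
(closing finitely many sites does not affect the existence of an infinite cluster,
`exists_infinite_siteCluster_diff_iff`). [cite: GeorgiiHiguchi2000, Lemma 5.5 (proof, p. 16)] -/
theorem measurableSet_prodCylinder_badPercolation (Λ : Finset (Site 2)) :
    MeasurableSet[(cylinderEvents (X := fun _ : Site 2 => ℤˣ) ((↑Λ : Set (Site 2))ᶜ)).prod
        (cylinderEvents (X := fun _ : Site 2 => ℤˣ) ((↑Λ : Set (Site 2))ᶜ))] {p : SpinConfig (Site 2) × SpinConfig (Site 2) |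
      ∃ x, (siteCluster (zdGraph 2) (spinSites 1 (badConfig p)) x).Infinite} := by
  classical
  have hE : {p : SpinConfig (Site 2) × SpinConfig (Site 2) |
      ∃ x, (siteCluster (zdGraph 2) (spinSites 1 (badConfig p)) x).Infinite} =
      (fun p : SpinConfig (Site 2) × SpinConfig (Site 2) => spinSites 1 (badConfig p) \ ↑Λ) ⁻¹'
        (⋃ x, sitePercolatesAt (zdGraph 2) x) := by
    ext p
    simp only [Set.mem_preimage, Set.mem_iUnion, sitePercolatesAt, Set.mem_setOf_eq]
    exact (exists_infinite_siteCluster_diff_iff (G := zdGraph 2) (spinSites 1 (badConfig p)) Λ).symm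
  rw [hE]
  exact measurable_spinSites_badConfig_diff Λ
    (MeasurableSet.iUnion fun x => measurableSet_sitePercolatesAt x)

/-- **Bad percolation is a product-tail event** (Georgii–Higuchi 2000, end of the proof of
Lemma 5.5: "this event is measurable with respect to the product-tail `𝒯⁽²⁾`"). [cite: GeorgiiHiguchi2000, Lemma 5.5 (proof, p. 16)] -/
theorem measurableSet_prodTailEvents_badPercolation :
    MeasurableSet[prodTailEvents (Site 2) ℤˣ] {p : SpinConfig (Site 2) × SpinConfig (Site 2) |
      ∃ x, (siteCluster (zdGraph 2) (spinSites 1 (badConfig p)) x).Infinite} :=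
  measurableSet_prodTailEvents_iff.2 fun Λ => measurableSet_prodCylinder_badPercolation Λ

/-- Bad percolation is measurable. [cite: GeorgiiHiguchi2000, Lemma 5.5 (proof, p. 16)] -/
theorem measurableSet_badPercolation :
    MeasurableSet {p : SpinConfig (Site 2) × SpinConfig (Site 2) |
      ∃ x, (siteCluster (zdGraph 2) (spinSites 1 (badConfig p)) x).Infinite} :=
  MeasurableSet.of_prodTailEvents measurableSet_prodTailEvents_badPercolation

/-- The event "the bad cluster of `t` is finite" is measurable. [folklore] -/
theorem measurableSet_badCluster_finite (t : Site 2) :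
    MeasurableSet {p : SpinConfig (Site 2) × SpinConfig (Site 2) |
      (siteCluster (zdGraph 2) (spinSites 1 (badConfig p)) t).Finite} := by
  classical
  have hE : {p : SpinConfig (Site 2) × SpinConfig (Site 2) |
      (siteCluster (zdGraph 2) (spinSites 1 (badConfig p)) t).Finite} =
      ((fun p : SpinConfig (Site 2) × SpinConfig (Site 2) => spinSites 1 (badConfig p)) ⁻¹'
        sitePercolatesAt (zdGraph 2) t)ᶜ := by
    ext p
    simp only [Set.mem_setOf_eq, Set.mem_compl_iff, Set.mem_preimage, sitePercolatesAt,
      Set.not_infinite]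
  rw [hE]
  exact (((measurable_spinSites 1).comp measurable_badConfig) (measurableSet_sitePercolatesAt t)).compl

end BadTail

/-! ### The 0–1 upgrade (end of the proof of Lemma 5.5) -/

section ZeroOne

variable {μ μ' : Measure (SpinConfig (Site 2))}

/-- **From positive probability to probability one** (Georgii–Higuchi 2000, end of the proof of
Lemma 5.5: "with probability at least `(θ/4)⁴` each finite set is surrounded by a `≤∗`circuit.
Since this event is measurable with respect to the product-tail `𝒯⁽²⁾` on which `ν̂` is trivial,
the lemma follows"): for tail-trivial probability measures `μ, μ'`, if for some `c > 0` and every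
`n` the `μ ⊗ μ'`-probability that no bad cluster meeting the box `Λ_n` is infinite is at least `c`,
then `μ ⊗ μ'`-almost surely no bad cluster is infinite. [cite: GeorgiiHiguchi2000, Lemma 5.5 (proof, p. 16)] -/
theorem measure_badPercolation_eq_zero_of_enclosure [IsProbabilityMeasure μ] [IsProbabilityMeasure μ']
    (hμ : IsTailTrivial μ) (hμ' : IsTailTrivial μ') {c : ℝ≥0∞} (hc : 0 < c)
    (h : ∀ n : ℕ, c ≤ μ.prod μ'
      {p | ∀ t ∈ box 2 n, (siteCluster (zdGraph 2) (spinSites 1 (badConfig p)) t).Finite}) :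
    μ.prod μ' {p : SpinConfig (Site 2) × SpinConfig (Site 2) |
      ∃ x, (siteCluster (zdGraph 2) (spinSites 1 (badConfig p)) x).Infinite} = 0 := by
  rcases hμ.prod hμ' measurableSet_prodTailEvents_badPercolation with h0 | h1
  · exact h0
  · exfalso
    set F : ℕ → Set (SpinConfig (Site 2) × SpinConfig (Site 2)) := fun n =>
      {p | ∀ t ∈ box 2 n, (siteCluster (zdGraph 2) (spinSites 1 (badConfig p)) t).Finite} with hF
    have hFm : ∀ n, MeasurableSet (F n) := fun n => by
      have : F n = ⋂ t ∈ box 2 n, {p : SpinConfig (Site 2) × SpinConfig (Site 2) |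
          (siteCluster (zdGraph 2) (spinSites 1 (badConfig p)) t).Finite} := by
        ext p; simp [hF]
      rw [this]
      exact Finset.measurableSet_biInter _ fun t _ => measurableSet_badCluster_finite t
    have hanti : Antitone F := fun n m hnm p hp t ht => hp t (box_mono 2 hnm ht)
    have hinter : (⋂ n, F n) = {p : SpinConfig (Site 2) × SpinConfig (Site 2) |
      ∃ x, (siteCluster (zdGraph 2) (spinSites 1 (badConfig p)) x).Infinite}ᶜ := by
      ext p
      simp only [Set.mem_iInter, hF, Set.mem_setOf_eq, Set.mem_compl_iff, not_exists, Set.not_infinite]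
      constructor
      · intro hp x
        obtain ⟨n, hn⟩ := (eventually_subset_box_holds (d := 2) {x}).exists
        exact hp n x (hn (Finset.mem_singleton_self x))
      · intro hp n t _
        exact hp t
    have hlim := tendsto_measure_iInter_atTop (μ := μ.prod μ')
      (fun n => (hFm n).nullMeasurableSet) hanti ⟨0, measure_ne_top _ _⟩
    rw [hinter, prob_compl_eq_one_sub measurableSet_badPercolation, h1, tsub_self] at hlim
    have hle : c ≤ 0 := ge_of_tendsto' hlim h
    exact (lt_irrefl 0) (hc.trans_le hle)

/-- Almost-sure form of `measure_badPercolation_eq_zero_of_enclosure`: under its hypotheses,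
`μ ⊗ μ'`-almost surely no lattice cluster of bad sites is infinite (the hypothesis of
`eq_of_no_bad_percolation`). [cite: GeorgiiHiguchi2000, Lemma 5.5 (proof, p. 16)] -/
theorem ae_no_badPercolation_of_enclosure [IsProbabilityMeasure μ] [IsProbabilityMeasure μ']
    (hμ : IsTailTrivial μ) (hμ' : IsTailTrivial μ') {c : ℝ≥0∞} (hc : 0 < c)
    (h : ∀ n : ℕ, c ≤ μ.prod μ'
      {p | ∀ t ∈ box 2 n, (siteCluster (zdGraph 2) (spinSites 1 (badConfig p)) t).Finite}) :
    ∀ᵐ p ∂(μ.prod μ'), ∀ t, ¬ (siteCluster (zdGraph 2) (spinSites 1 (badConfig p)) t).Infinite := by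
  rw [ae_iff]
  have : {p : SpinConfig (Site 2) × SpinConfig (Site 2) |
      ¬ ∀ t, ¬ (siteCluster (zdGraph 2) (spinSites 1 (badConfig p)) t).Infinite} = {p : SpinConfig (Site 2) × SpinConfig (Site 2) |
      ∃ x, (siteCluster (zdGraph 2) (spinSites 1 (badConfig p)) x).Infinite} := by
    ext p; simp only [Set.mem_setOf_eq, not_forall, not_not]
  rw [this]
  exact measure_badPercolation_eq_zero_of_enclosure hμ hμ' hc h

end ZeroOne

/-! ### Translations: covariance, interchanging the layers, generators -/

section Shifts

variable {d : ℕ}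

/-- `configShift v` is the relabelling along the translation `x ↦ x + v`. [folklore] -/
theorem configShift_eq_configRelabel (v : Site d) :
    (configShift (S := ℤˣ) v : SpinConfig (Site d) → SpinConfig (Site d)) =
      configRelabel (Site.shift v) := rfl

/-- `θ_{-v} ∘ θ_v = id` on configurations. [folklore] -/
theorem configShift_neg_comp (v : Site d) :
    (configShift (S := ℤˣ) (-v) : SpinConfig (Site d) → SpinConfig (Site d)) ∘ configShift v = id := by
  funext σ; funext x
  simp only [Function.comp_apply, configShift_apply, id_eq, sub_neg_eq_add, add_sub_cancel_right]

/-- `θ_v ∘ θ_{-v} = id` on configurations. [folklore] -/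
theorem configShift_comp_neg (v : Site d) :
    (configShift (S := ℤˣ) v : SpinConfig (Site d) → SpinConfig (Site d)) ∘ configShift (-v) = id := by
  funext σ; funext x
  simp only [Function.comp_apply, configShift_apply, id_eq, sub_neg_eq_add, sub_add_cancel]

/-- `θ_{u+w} = θ_u ∘ θ_w` on configurations. [folklore] -/
theorem configShift_add_eq_comp (u w : Site d) :
    (configShift (S := ℤˣ) (u + w) : SpinConfig (Site d) → SpinConfig (Site d)) =
      configShift u ∘ configShift w := by
  funext σ; funext x
  simp only [Function.comp_apply, configShift_apply]
  congr 1; abel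

/-- **`𝒢(β, h)` is translation covariant**: the translate `μ ∘ θ_v⁻¹` of an infinite-volume Ising
Gibbs measure on `ℤ^d` is again one (Georgii–Higuchi 2000, §2, p. 3; `IsGibbsMeasure.map_configRelabel`
for the automorphism `zdShiftIso v`). [cite: GeorgiiHiguchi2000, §2 p. 3] -/
theorem mem_isingGibbsMeasures_map_configShift {β h : ℝ} {μ : Measure (SpinConfig (Site d))}
    (hμ : μ ∈ isingGibbsMeasures d β h) (v : Site d) :
    μ.map (configShift v) ∈ isingGibbsMeasures d β h := by
  have hμG : IsGibbsMeasure (isingSpecification (zdGraph d) β h) μ := hμ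
  have hT : (configShift (S := ℤˣ) v : SpinConfig (Site d) → SpinConfig (Site d)) =
      configRelabel (zdShiftIso v).toEquiv := rfl
  show IsGibbsMeasure (isingSpecification (zdGraph d) β h) (μ.map (configShift v))
  rw [hT]
  exact IsGibbsMeasure.map_configRelabel _ (zdShiftIso v) hμG

/-- Bad sites are translation covariant: `S_bad(θ_v ω, θ_v ω̂) = S_bad(ω, ω̂) + v`. [folklore] -/
theorem spinSites_badConfig_prodMap_configShift (v : Site 2) (p : SpinConfig (Site 2) × SpinConfig (Site 2)) :
    spinSites 1 (badConfig (Prod.map (configShift v) (configShift v) p)) =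
      (zdShiftIso v) '' spinSites 1 (badConfig p) := by
  have hcfg : badConfig (Prod.map (configShift v) (configShift v) p) =
      configRelabel (Site.shift v) (badConfig p) := by
    funext z
    simp only [badConfig, Prod.map_fst, Prod.map_snd, configShift_apply, configRelabel_apply,
      Site.shift_symm_apply]
  rw [hcfg, spinSites_configRelabel]
  rfl

/-- No bad percolation is a translation invariant property of the pair. [folklore] -/
theorem forall_not_infinite_badCluster_prodMap_configShift_iff (v : Site 2)
    (p : SpinConfig (Site 2) × SpinConfig (Site 2)) :
    (∀ t, ¬ (siteCluster (zdGraph 2) (spinSites 1 (badConfig (Prod.map (configShift v) (configShift v) p))) t).Infinite) ↔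
      ∀ t, ¬ (siteCluster (zdGraph 2) (spinSites 1 (badConfig p)) t).Infinite := by
  rw [spinSites_badConfig_prodMap_configShift]
  have key : ∀ y, siteCluster (zdGraph 2) ((zdShiftIso v) '' spinSites 1 (badConfig p)) (zdShiftIso v y) =
      (zdShiftIso v) '' siteCluster (zdGraph 2) (spinSites 1 (badConfig p)) y := fun y => by
    have h := siteCluster_relabel (zdShiftIso v) (spinSites 1 (badConfig p)) y
    rwa [SiteConfig.relabel_apply] at h
  constructor
  · intro h y hy
    refine h (zdShiftIso v y) ?_
    rw [key]
    exact hy.image (zdShiftIso v).injective.injOn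
  · intro h t ht
    refine h ((zdShiftIso v).symm t) ?_
    have hk := key ((zdShiftIso v).symm t)
    rw [RelIso.apply_symm_apply] at hk
    rw [hk] at ht
    exact Set.Infinite.of_image _ ht

/-- **Interchanging the layers** (Georgii–Higuchi 2000, end of the proof of Prop. 5.1:
"Interchanging `μ` and `μ̂` (i.e., the roles of the layers) we get the reverse relation"): the
absence of bad percolation under `(μ ∘ θ_v⁻¹) ⊗ μ` is the absence of bad percolation under
`μ ⊗ (μ ∘ θ_{-v}⁻¹)`, transported along `θ_v × θ_v`. [cite: GeorgiiHiguchi2000, Prop. 5.1 (proof, p. 16)] -/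
theorem ae_no_badPercolation_prod_map_configShift {μ : Measure (SpinConfig (Site 2))} [IsProbabilityMeasure μ]
    (v : Site 2)
    (h : ∀ᵐ p ∂(μ.prod (μ.map (configShift (-v)))),
      ∀ t, ¬ (siteCluster (zdGraph 2) (spinSites 1 (badConfig p)) t).Infinite) :
    ∀ᵐ p ∂((μ.map (configShift v)).prod μ),
      ∀ t, ¬ (siteCluster (zdGraph 2) (spinSites 1 (badConfig p)) t).Infinite := by
  have hT : Measurable (configShift (S := ℤˣ) v : SpinConfig (Site 2) → SpinConfig (Site 2)) :=
    (configShift v).measurable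
  have hT' : Measurable (configShift (S := ℤˣ) (-v) : SpinConfig (Site 2) → SpinConfig (Site 2)) :=
    (configShift (-v)).measurable
  haveI : IsProbabilityMeasure (μ.map (configShift (S := ℤˣ) (-v))) :=
    Measure.isProbabilityMeasure_map hT'.aemeasurable
  have hprod : (μ.prod (μ.map (configShift (S := ℤˣ) (-v)))).map (Prod.map (configShift v) (configShift v)) =
      (μ.map (configShift v)).prod μ := by
    rw [← Measure.map_prod_map _ _ hT hT, Measure.map_map hT hT', configShift_comp_neg, Measure.map_id]
  rw [← hprod]
  have hset : MeasurableSet {p : SpinConfig (Site 2) × SpinConfig (Site 2) |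
      ∀ t, ¬ (siteCluster (zdGraph 2) (spinSites 1 (badConfig p)) t).Infinite} := by
    have : {p : SpinConfig (Site 2) × SpinConfig (Site 2) |
        ∀ t, ¬ (siteCluster (zdGraph 2) (spinSites 1 (badConfig p)) t).Infinite} = {p : SpinConfig (Site 2) × SpinConfig (Site 2) |
      ∃ x, (siteCluster (zdGraph 2) (spinSites 1 (badConfig p)) x).Infinite}ᶜ := by
      ext p; exact not_mem_badPercolation_iff.symm
    rw [this]
    exact measurableSet_badPercolation.compl
  rw [ae_map_iff (hT.prodMap hT).aemeasurable hset]
  filter_upwards [h] with p hp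
  exact (forall_not_infinite_badCluster_prodMap_configShift_iff v p).2 hp

/-- **Invariance under the unit translations gives translation invariance**: the vectors `v` with
`μ ∘ θ_v⁻¹ = μ` form a subgroup of `ℤ^d`, which is all of `ℤ^d` once it contains the unit vectors
`e_i` (Georgii–Higuchi 2000, Prop. 5.1: "`μ = μ∘θ_h⁻¹` and `μ = μ∘θ_v⁻¹`"). [cite: GeorgiiHiguchi2000, Prop. 5.1] -/
theorem isTranslationInvariantMeasure_of_generators {μ : Measure (SpinConfig (Site d))}
    (h : ∀ i : Fin d, μ.map (configShift (Pi.single i 1)) = μ) : IsTranslationInvariantMeasure μ := by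
  have hmeas : ∀ v : Site d, Measurable (configShift (S := ℤˣ) v : SpinConfig (Site d) → SpinConfig (Site d)) :=
    fun v => (configShift v).measurable
  have h0 : μ.map (configShift (S := ℤˣ) (0 : Site d)) = μ := by
    have : (configShift (S := ℤˣ) (0 : Site d) : SpinConfig (Site d) → SpinConfig (Site d)) = id := by
      funext σ; funext x; simp
    rw [this, Measure.map_id]
  have hadd : ∀ u w : Site d, μ.map (configShift u) = μ → μ.map (configShift w) = μ →
      μ.map (configShift (u + w)) = μ := by
    intro u w hu hw
    rw [configShift_add_eq_comp, ← Measure.map_map (hmeas u) (hmeas w), hw, hu]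
  have hneg : ∀ u : Site d, μ.map (configShift u) = μ → μ.map (configShift (-u)) = μ := by
    intro u hu
    conv_lhs => rw [← hu]
    rw [Measure.map_map (hmeas (-u)) (hmeas u), configShift_neg_comp, Measure.map_id]
  let H : AddSubgroup (Site d) :=
    { carrier := {v | μ.map (configShift v) = μ}
      zero_mem' := h0
      add_mem' := fun {u w} hu hw => hadd u w hu hw
      neg_mem' := fun {u} hu => hneg u hu }
  intro v
  have hv : v ∈ H := by
    rw [← Finset.univ_sum_single v]
    refine H.sum_mem fun i _ => ?_
    have hsingle : (Pi.single i (v i) : Site d) = (v i) • (Pi.single i (1 : ℤ) : Site d) := by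
      funext j
      by_cases hj : j = i
      · subst hj; simp
      · simp [hj]
    rw [hsingle]
    exact H.zsmul_mem (h i) _
  exact hv

end Shifts

/-! ### Proposition 5.1 and the theorem -/

section Assembly

variable {β : ℝ}

/-- **Georgii–Higuchi 2000, Prop. 5.1 from Lemma 5.5 (almost-sure form).** For `β ≥ 0` and a
tail-trivial `μ ∈ 𝒢(β, 0)` on `ℤ²`: if for each of the four unit vectors `v = ±e_i`, almost surely
under `μ ⊗ (μ ∘ θ_v⁻¹)` no lattice cluster of bad sites `{ω = +1, ω̂ = -1}` is infinite, then `μ`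
is translation invariant ("`μ ≼ μ̂`; interchanging the roles of the layers we get the reverse
relation. Hence `μ = μ̂` … The vertical invariance follows similarly"). [cite: GeorgiiHiguchi2000, Prop. 5.1 (proof, p. 16)] -/
theorem isTranslationInvariantMeasure_of_ae_no_badPercolation (hβ : 0 ≤ β)
    {μ : Measure (SpinConfig (Site 2))} (hμ : μ ∈ isingGibbsMeasures 2 β 0)
    (h : ∀ (i : Fin 2) (s : ℤˣ),
      ∀ᵐ p ∂(μ.prod (μ.map (configShift (Pi.single i (s : ℤ))))),
        ∀ t, ¬ (siteCluster (zdGraph 2) (spinSites 1 (badConfig p)) t).Infinite) :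
    IsTranslationInvariantMeasure μ := by
  have hμG : IsGibbsMeasure (isingSpecification (zdGraph 2) β 0) μ := hμ
  haveI := hμG.isProbabilityMeasure
  refine isTranslationInvariantMeasure_of_generators fun i => ?_
  have h1 := h i 1
  have h2 := h i (-1)
  simp only [Units.val_one] at h1
  have hneg : (Pi.single i ((-1 : ℤˣ) : ℤ) : Site 2) = -Pi.single i 1 := by
    rw [Units.val_neg, Units.val_one, Pi.single_neg]
  rw [hneg] at h2
  exact (eq_of_no_bad_percolation hβ hμ (mem_isingGibbsMeasures_map_configShift hμ _) h1
    (ae_no_badPercolation_prod_map_configShift _ h2)).symm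

/-- **The Aizenman–Higuchi theorem from Lemma 5.5 of Georgii–Higuchi (almost-sure form).** If for
`β > β_c(2)`, every tail-trivial `μ ∈ 𝒢(β, 0)` on `ℤ²` and each unit vector `v = ±e_i`, almost
surely under `μ ⊗ (μ ∘ θ_v⁻¹)` no lattice cluster of bad sites `{ω = +1, ω̂ = -1}` is infinite
(Lemma 5.5: "`ν̂`-almost surely each finite square is surrounded by a `≤∗`circuit"), then the named
fact `aizenman_higuchi` holds at `β` (Prop. 5.1 and "Together with Corollary 3.2 this will
immediately imply the main theorem"). [cite: GeorgiiHiguchi2000, Lemma 5.5, Prop. 5.1 and Thm. (p. 12)] -/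
theorem aizenman_higuchi_of_ae_no_badPercolation
    (h55 : criticalBeta 2 < β → ∀ μ ∈ isingGibbsMeasures 2 β 0, IsTailTrivial μ →
      ∀ (i : Fin 2) (s : ℤˣ),
        ∀ᵐ p ∂(μ.prod (μ.map (configShift (Pi.single i (s : ℤ))))),
          ∀ t, ¬ (siteCluster (zdGraph 2) (spinSites 1 (badConfig p)) t).Infinite) :
    aizenman_higuchi (β := β) := by
  refine aizenman_higuchi_of_tailTrivial_translationInvariant fun hβ μ hμ hμt => ?_
  have hβ0 : 0 ≤ β := (criticalBeta_nonneg 2).trans hβ.le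
  exact isTranslationInvariantMeasure_of_ae_no_badPercolation hβ0 hμ (h55 hβ μ hμ hμt)

/-- **The Aizenman–Higuchi theorem from Lemma 5.5 of Georgii–Higuchi (positive-probability
form).** If for `β > β_c(2)`, every tail-trivial `μ ∈ 𝒢(β, 0)` on `ℤ²` and each unit vector
`v = ±e_i` there is `c > 0` such that for every box `Λ_n`, with `μ ⊗ (μ ∘ θ_v⁻¹)`-probability at
least `c` no cluster of bad sites `{ω = +1, ω̂ = -1}` meeting `Λ_n` is infinite (Georgii–Higuchi
prove this with `c = (θ/4)⁴` from `≤∗`paths above and below `Λ_n`, Cases 1–3 of the proof of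
Lemma 5.5), then the named fact `aizenman_higuchi` holds at `β`: product-tail triviality upgrades
the bound to probability one (`ae_no_badPercolation_of_enclosure`), and Prop. 5.1 with Cor. 3.2
conclude (`aizenman_higuchi_of_ae_no_badPercolation`). [cite: GeorgiiHiguchi2000, Lemma 5.5 (proof, p. 16), Prop. 5.1 and Thm. (p. 12)] -/
theorem aizenman_higuchi_of_enclosure_bound
    (h55 : criticalBeta 2 < β → ∀ μ ∈ isingGibbsMeasures 2 β 0, IsTailTrivial μ →
      ∀ (i : Fin 2) (s : ℤˣ), ∃ c : ℝ≥0∞, 0 < c ∧ ∀ n : ℕ,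
        c ≤ (μ.prod (μ.map (configShift (Pi.single i (s : ℤ)))))
          {p | ∀ t ∈ box 2 n, (siteCluster (zdGraph 2) (spinSites 1 (badConfig p)) t).Finite}) :
    aizenman_higuchi (β := β) := by
  refine aizenman_higuchi_of_ae_no_badPercolation fun hβ μ hμ hμt i s => ?_
  have hμG : IsGibbsMeasure (isingSpecification (zdGraph 2) β 0) μ := hμ
  haveI := hμG.isProbabilityMeasure
  set v : Site 2 := Pi.single i (s : ℤ) with hv
  haveI : IsProbabilityMeasure (μ.map (configShift (S := ℤˣ) v)) :=
    Measure.isProbabilityMeasure_map (configShift v).measurable.aemeasurable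
  have hμt' : IsTailTrivial (μ.map (configShift (S := ℤˣ) v)) := hμt.map_configRelabel (Site.shift v)
  obtain ⟨c, hc, hcn⟩ := h55 hβ μ hμ hμt i s
  exact ae_no_badPercolation_of_enclosure hμt hμt' hc hcn

end Assembly

end Literature.Probability.LatticeModels
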